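import Summits.CriticalPhenomena.PercolationContinuityZ3.Theorems.PercNearOneGluingNoHeavyLowerTailSunflowerBlowup
import Summits.CriticalPhenomena.PercolationContinuityZ3.Theorems.PercNearOneGluingNoHeavyLowerTailSunflowerGradedSafeCNF
import Summits.CriticalPhenomena.PercolationContinuityZ3.Theorems.PercNearOneGluingNoHeavyLowerTailSunflowerGradedSafe
import HarnessLib

/-!
# `NoHeavyLowerTail` (crux stmt-CriticalPhenomena-4575), abstract sunflower cubic: GRADED SAFETY IS INVARIANT UNDER BLOW-UP
# (OR-substitution of fresh coordinate blocks preserves `GSafe`; graph cores of blow-ups)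

Support file (seat `prim-ineq-prove-1` gen 47; `--supports stmt-CriticalPhenomena-4575`).  No `sorry`, no named facts.  Memo:
run/shared/lean/prim/prim-ineq-prove-1/FINDING-GSC5-prove1-g47.md §7 (Lemma 7).

`SafeCalc.GSafe p a A` (…SunflowerGradedSafe) is the graded form of safety that drives the disjunction rule `safe_union_of_gsafe`
("GS ∨ SAFE = SAFE on disjoint blocks").  `…SunflowerBlowup` proved that plain safety is invariant under the OR-aggregation map
`orMap f ω = f '' ω` (`safe_preimage_orMap`).  This file proves the same for GRADED safety on the full block:

* **`gsafe_preimage_orMap`** — for a surjective `f : ι → κ` and an event `B ⊆ Set κ`: `GSafe (orParam f p) univ B → GSafe p univ (orMap f ⁻¹' B)`.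
  PROOF (memo Lemma 7).  Given the graded petal functions `G i` on the missing sets `T ⊆ ι`, replace `T` by the union `piM 𝒞 T` of the
  ENTIRELY missed fibres `f ⁻¹ y` (antitonicity; `𝒞` = the fibres of `f`, pairwise disjoint clauses), reindex the block expectation to the
  meta-cube of fibres (`BEx_piM`), identify the meta-cube weights with the cylinder weights of the aggregated parameter `orParam f p`
  (`one_sub_orParam`), and apply the hypothesis to `G' i T' := G i (f ⁻¹ T')`; good/bad block points correspond because
  `f '' (ι ∖ f ⁻¹ T') = κ ∖ T'` for surjective `f`; finally `μ_p(orMap f ⁻¹' B) = μ_{orParam f p}(B)` (`real_preimage_orMap`).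
* **`gsafe_edgeCore_comap`** — graph cores: `GSafe (orParam f p) univ (edgeCore Δ) → GSafe p univ (edgeCore (Δ.comap f))` for surjective `f`
  (every blow-up of a graph with a gradedly safe core has a gradedly safe core at the corresponding parameter), and the "A-GS" form
  `aGSafe_edgeCore_comap`.
Use (memo Cor. 2(b)): with GS of the pentagon core (memo Thm 1, exact certificate, not in Lean) every blow-up `C₅[n₀,…,n₄]` is GS, hence
`C₅[n⃗] ⊔ Γ` is safe for every safe `Γ` (`safe_union_of_gsafe`), and the GS class is closed under blow-up and `⊔` (`gsafe_union`).
-/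

noncomputable section

namespace Summit.CriticalPhenomena.PercolationContinuityZ3.Theorems.SunflowerPartition

namespace SafeCalc

open MeasureTheory Finset
open Literature.Probability.LatticeModels Literature.Probability.Percolation
open TwoGenCore (wmiss)

variable {ι κ : Type*}

/-- Membership in a fibre `univ.filter (f · = y)` (the "clause" of the block `y`). [this work] -/
theorem mem_fibre [Fintype ι] [DecidableEq κ] (f : ι → κ) (y : κ) (x : ι) : x ∈ univ.filter (fun x => f x = y) ↔ f x = y := by
  simp

/-- Fibres of a surjective map are injective in the base point. [this work] -/
theorem fibre_injective [Fintype ι] [DecidableEq κ] (f : ι → κ) (hf : Function.Surjective f) :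
    Function.Injective (fun y => univ.filter (fun x => f x = y)) := by
  intro y y' h
  obtain ⟨x, rfl⟩ := hf y
  have hx : x ∈ univ.filter (fun x' => f x' = f x) := (mem_fibre f (f x) x).2 rfl
  have h' : univ.filter (fun x' => f x' = f x) = univ.filter (fun x' => f x' = y') := h
  rw [h'] at hx
  exact ((mem_fibre f y' x).1 hx).symm ▸ rfl

/-- Distinct fibres are disjoint. [this work] -/
theorem disjoint_fibre [Fintype ι] [DecidableEq κ] (f : ι → κ) {y y' : κ} (h : y ≠ y') :
    Disjoint (univ.filter (fun x => f x = y)) (univ.filter (fun x => f x = y')) := by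
  rw [Finset.disjoint_left]
  intro x hx hx'
  exact h (((mem_fibre f y x).1 hx).symm.trans ((mem_fibre f y' x).1 hx'))

/-- Membership in the preimage finset `univ.filter (f · ∈ T')`. [this work] -/
theorem mem_prePre [Fintype ι] [DecidableEq κ] (f : ι → κ) (T' : Finset κ) (x : ι) : x ∈ univ.filter (fun x => f x ∈ T') ↔ f x ∈ T' := by
  simp

/-- The union of the fibres over `T'` is the preimage of `T'`. [this work] -/
theorem biUnion_image_fibre [Fintype ι] [DecidableEq ι] [DecidableEq κ] (f : ι → κ) (T' : Finset κ) :
    (T'.image (fun y => univ.filter (fun x => f x = y))).biUnion id = univ.filter (fun x => f x ∈ T') := by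
  ext x
  simp only [Finset.mem_biUnion, Finset.mem_image, id, mem_prePre]
  constructor
  · rintro ⟨C, ⟨y, hy, rfl⟩, hx⟩
    exact ((mem_fibre f y x).1 hx) ▸ hy
  · intro hx
    exact ⟨univ.filter (fun x' => f x' = f x), ⟨f x, hx, rfl⟩, (mem_fibre f (f x) x).2 rfl⟩

/-- For surjective `f`, the hit set of the complement of a preimage is the complement: `f '' (ι ∖ f⁻¹T') = κ ∖ T'`. [this work] -/
theorem orMap_compl_prePre [Fintype ι] [DecidableEq ι] [Fintype κ] [DecidableEq κ] (f : ι → κ) (hf : Function.Surjective f) (T' : Finset κ) :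
    orMap f (((univ \ univ.filter (fun x => f x ∈ T') : Finset ι)) : Set ι) = (((univ \ T' : Finset κ)) : Set κ) := by
  ext y
  simp only [orMap, Set.mem_image, Finset.coe_sdiff, Finset.coe_univ, Set.mem_sdiff, Set.mem_univ, true_and,
    Finset.mem_coe, mem_prePre]
  constructor
  · rintro ⟨x, hx, rfl⟩
    exact hx
  · intro hy
    obtain ⟨x, rfl⟩ := hf y
    exact ⟨x, hy, rfl⟩

/-- The clause probability of a fibre is the aggregated parameter. [this work] -/
theorem pClause_fibre [Fintype ι] [DecidableEq κ] (f : ι → κ) (p : ι → unitInterval) (y : κ) :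
    pClause p (univ.filter (fun x => f x = y)) = (orParam f p y : ℝ) := by
  unfold pClause
  have h := one_sub_orParam f p y
  linarith [h]

/-- The meta-cube weight of the image of `T'` is the cylinder weight of `T'` for the aggregated parameter. [this work] -/
theorem Wt_image_fibre [Fintype ι] [DecidableEq ι] [Fintype κ] [DecidableEq κ] (f : ι → κ) (hf : Function.Surjective f) (p : ι → unitInterval) (T' : Finset κ) :
    Wt p (univ.image (fun y => univ.filter (fun x => f x = y))) (T'.image (fun y => univ.filter (fun x => f x = y))) =
      wmiss (orParam f p) univ T' := by
  unfold Wt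
  rw [Finset.prod_image (fun y _ y' _ h => fibre_injective f hf h)]
  have hmem : ∀ y : κ, (univ.filter (fun x => f x = y) ∈ T'.image (fun y => univ.filter (fun x => f x = y))) ↔ y ∈ T' := by
    intro y
    rw [Finset.mem_image]
    constructor
    · rintro ⟨y', hy', h⟩
      exact (fibre_injective f hf h) ▸ hy'
    · intro hy
      exact ⟨y, hy, rfl⟩
  have h1 : (∏ y : κ, if univ.filter (fun x => f x = y) ∈ T'.image (fun y => univ.filter (fun x => f x = y))
        then 1 - pClause p (univ.filter (fun x => f x = y)) else pClause p (univ.filter (fun x => f x = y))) =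
      ∏ y : κ, (if y ∈ T' then 1 - (orParam f p y : ℝ) else (orParam f p y : ℝ)) := by
    refine Finset.prod_congr rfl fun y _ => ?_
    rw [pClause_fibre]
    by_cases hy : y ∈ T'
    · rw [if_pos ((hmem y).2 hy), if_pos hy]
    · rw [if_neg (fun h => hy ((hmem y).1 h)), if_neg hy]
  rw [h1, Finset.prod_ite, Finset.filter_mem_eq_inter, Finset.univ_inter, Finset.filter_not, Finset.filter_mem_eq_inter,
    Finset.univ_inter]
  rfl

/-- **GRADED SAFETY IS INVARIANT UNDER OR-SUBSTITUTION.**  For a surjective block map `f : ι → κ`: if `B ⊆ Set κ` is gradedly safe on the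
full block for the aggregated parameter `orParam f p`, then its pull-back `orMap f ⁻¹' B` is gradedly safe on the full block for `p`.
[this work] -/
theorem gsafe_preimage_orMap [Fintype ι] [DecidableEq ι] [Fintype κ] [DecidableEq κ] (f : ι → κ) (hf : Function.Surjective f) (p : ι → unitInterval) {B : Set (Set κ)}
    (hB : GSafe (orParam f p) univ B) : GSafe p univ (orMap f ⁻¹' B) := by
  classical
  intro n c hc hc1 G hanti hle1 hge hgood hbad
  set q : κ → unitInterval := orParam f p with hq
  set 𝒞 : Finset (Finset ι) := univ.image (fun y => univ.filter (fun x => f x = y)) with h𝒞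
  -- the fibres are pairwise disjoint clauses covering everything
  have hdis : ∀ C ∈ 𝒞, ∀ D ∈ 𝒞, C ≠ D → Disjoint C D := by
    intro C hC D hD hne
    rw [h𝒞, Finset.mem_image] at hC hD
    obtain ⟨y, _, rfl⟩ := hC
    obtain ⟨y', _, rfl⟩ := hD
    exact disjoint_fibre f (fun h => hne (h ▸ rfl))
  have huniv : 𝒞.biUnion id = univ := by
    rw [h𝒞, biUnion_image_fibre]
    ext x
    simp
  have hpiM : ∀ T : Finset ι, piM 𝒞 T ⊆ T := fun T =>
    Finset.biUnion_subset.2 fun C hC => by simpa [fullMiss] using (Finset.mem_filter.1 hC).2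
  -- step 1: min-type reduction along the fibres
  have h1 : ∏ i, BEx p univ (G i) ≤ ∏ i, BEx p univ (fun T => G i (piM 𝒞 T)) :=
    Finset.prod_le_prod (fun i _ => BEx_nonneg p univ fun T hT => hc.le.trans (hge i T hT))
      fun i _ => BEx_mono p univ fun T hT => hanti i _ _ (hpiM T) hT
  refine h1.trans ?_
  -- step 2: reindex to the meta-cube of fibres and then to the base cube
  set G' : Fin n → Finset κ → ℝ := fun i T' => G i (univ.filter (fun x => f x ∈ T')) with hG'
  have h2 : ∀ i, BEx p univ (fun T => G i (piM 𝒞 T)) = BEx q univ (G' i) := by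
    intro i
    have e1 : BEx p univ (fun T => G i (piM 𝒞 T)) = BEx p (𝒞.biUnion id) (fun T => G i (piM 𝒞 T)) := by rw [huniv]
    rw [e1, BEx_piM p 𝒞 hdis (G i)]
    unfold BEx
    symm
    refine Finset.sum_bij' (fun T' _ => T'.image (fun y => univ.filter (fun x => f x = y)))
      (fun J _ => univ.filter (fun y => univ.filter (fun x => f x = y) ∈ J)) ?_ ?_ ?_ ?_ ?_
    · intro T' _
      exact Finset.mem_powerset.2 (Finset.image_subset_image (Finset.subset_univ T'))
    · intro J _
      exact Finset.mem_powerset.2 (Finset.subset_univ _)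
    · intro T' _
      ext y
      simp only [Finset.mem_filter, Finset.mem_univ, true_and, Finset.mem_image]
      constructor
      · rintro ⟨y', hy', h⟩
        exact (fibre_injective f hf h) ▸ hy'
      · intro hy
        exact ⟨y, hy, rfl⟩
    · intro J hJ
      rw [Finset.mem_powerset] at hJ
      ext C
      simp only [Finset.mem_image, Finset.mem_filter, Finset.mem_univ, true_and]
      constructor
      · rintro ⟨y, hy, rfl⟩
        exact hy
      · intro hC
        have hC' := hJ hC
        rw [h𝒞, Finset.mem_image] at hC'
        obtain ⟨y, _, rfl⟩ := hC'
        exact ⟨y, hC, rfl⟩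
    · intro T' _
      rw [Wt_image_fibre f hf p T', hG']
      simp only
      rw [biUnion_image_fibre]
  rw [Finset.prod_congr rfl fun i _ => h2 i]
  -- step 3: the hypothesis for the pushed-forward functions
  have hgood_bad : ∀ T' : Finset κ,
      ((((univ \ univ.filter (fun x => f x ∈ T') : Finset ι)) : Set ι) ∈ orMap f ⁻¹' B) ↔ ((((univ \ T' : Finset κ)) : Set κ) ∈ B) := by
    intro T'
    rw [Set.mem_preimage, orMap_compl_prePre f hf T']
  have key := hB n c hc hc1 G'
    (fun i T T' hTT' _ => hanti i (univ.filter (fun x => f x ∈ T)) (univ.filter (fun x => f x ∈ T'))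
      (fun x hx => (mem_prePre f T' x).2 (hTT' ((mem_prePre f T x).1 hx))) (Finset.subset_univ _))
    (fun i T' _ => hle1 i _ (Finset.subset_univ _))
    (fun i T' _ => hge i _ (Finset.subset_univ _))
    (fun i T' _ hgoodT => hgood i _ (Finset.subset_univ _) ((hgood_bad T').2 hgoodT))
    (fun T' _ hbadT => hbad _ (Finset.subset_univ _) (fun h => hbadT ((hgood_bad T').1 h)))
  rw [real_preimage_orMap]
  exact key

/-- **GRAPH CORES: GRADED SAFETY IS INVARIANT UNDER BLOW-UP.**  If the graph core of `Δ` is gradedly safe (full block) at the aggregated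
parameter, then the graph core of the blow-up `Δ.comap f` (`f` surjective) is gradedly safe at `p`. [this work] -/
theorem gsafe_edgeCore_comap [Fintype ι] [DecidableEq ι] [Fintype κ] [DecidableEq κ] (f : ι → κ) (hf : Function.Surjective f) (Δ : SimpleGraph κ) (p : ι → unitInterval)
    (h : GSafe (orParam f p) univ (edgeCore Δ)) : GSafe p univ (edgeCore (Δ.comap f)) := by
  rw [edgeCore_comap]
  exact gsafe_preimage_orMap f hf p h

/-- **A-GS is invariant under blow-up**: if the graph core of `Δ` is gradedly safe on the full block for EVERY parameter vector, then so
is the graph core of every blow-up `Δ.comap f` with `f` surjective (classes of any positive sizes). [this work] -/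
theorem aGSafe_edgeCore_comap [Fintype ι] [DecidableEq ι] [Fintype κ] [DecidableEq κ] (f : ι → κ) (hf : Function.Surjective f) (Δ : SimpleGraph κ)
    (h : ∀ q : κ → unitInterval, GSafe q univ (edgeCore Δ)) (p : ι → unitInterval) : GSafe p univ (edgeCore (Δ.comap f)) :=
  gsafe_edgeCore_comap f hf Δ p (h _)

end SafeCalc

end Summit.CriticalPhenomena.PercolationContinuityZ3.Theorems.SunflowerPartition
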